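import Summits.CriticalPhenomena.Ising3DConformalLimit.Theses.FKParityRobustness
import Summits.CriticalPhenomena.Ising3DConformalLimit.Theorems.FKParityRobustnessDefs
import Literature.Probability.LatticeModels.LoopO1
import Literature.Probability.LatticeModels.RandomClusterFKG
import Literature.Combinatorics.SimpleGraph.CycleSpaceSeparators
import Literature.Combinatorics.SimpleGraph.CycleSpaceSeparatorsGeneral
import HarnessLib

/-!
# The even-subgraph count: stub `stub_evenSubgraphCount` of line `plaquette-xor-surgery`
# for crux `ParityRobustMerging` (stmt-CriticalPhenomena-11253)

Route `FKParityRobustness`.  For a finite graph `G` on the vertex type `V` and an edge set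
`ω ⊆ E(G)`, the number of EVEN SUBGRAPHS of `ω` (edge sets `F ⊆ ω` all of whose degrees are even,
the tree's `evenSubgraphs G ω = 𝓔_∅(ω)` of `Literature/Probability/LatticeModels/LoopO1.lean`)
satisfies the cycle-space count

  `#𝓔_∅(ω) · 2^{|V|} = 2^{|ω| + k(ω)}`,

where `k(ω) = clusterCount ω ∅` is the number of connected components of the spanning subgraph
`(V, ω)` (isolated vertices included).  Equivalently `dim_{𝔽₂} 𝓔_∅(ω) = |ω| − |V| + k(ω)`; the
subtraction-free form is the registered statement.

Proof (induction on `ω`, one edge `e = uv` at a time):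
* `ω = ∅`: `𝓔_∅(∅) = {∅}` and `k(∅) = |V|`;
* if `u`, `v` lie in different components of `(V, ω)`, then `k` drops by exactly one and no even
  subgraph of `ω + e` uses `e` (removing `e` from such a subgraph would leave `u` as an odd vertex
  of a subgraph of `ω` whose only other odd vertex `v` is in another component — handshake);
* if `u`, `v` lie in the same component, then `k` is unchanged and `𝓔_∅(ω + e)` doubles: for a
  `u`–`v` path `π ⊆ ω` the cycle `C = π + e` is even, and `S ↦ C ∆ S` is a bijection between the
  even subgraphs of `ω` and the even subgraphs of `ω + e` containing `e`.

* `clusterCount_coe_empty` — `clusterCount ↑ω ∅ = #components of fromEdgeSet ↑ω`;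
* `card_connectedComponent_bot_eq_card` — `k(⊥) = |V|`;
* `mem_evenSubgraphs_iff` — for `ω ⊆ E(G)`: `F ∈ 𝓔_∅(ω) ↔ F ⊆ ω ∧ IsEvenEdgeSet F`;
* `mk_notMem_of_isEvenEdgeSet`, `exists_isEvenEdgeSet_insert_of_reachable`,
  `evenSubgraphs_insert_of_not_reachable`, `card_evenSubgraphs_insert_of_reachable` — the two cases;
* `card_evenSubgraphs_mul_two_pow` — the count, `stub_evenSubgraphCount` — the registered stub.

Theorem-only file; Mathlib + the tree's `LoopO1`, `RandomClusterFKG` (component counts under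
adding one edge) and `CycleSpaceSeparators(General)` (degrees of edge sets, handshake, path
parities).  References: G. Grimmett, S. Janson, *Random even graphs*, Electron. J. Combin. 16
(2009), §1 (the even subgraphs form an `𝔽₂`-space of dimension `|E| − |V| + k`); R. Diestel,
*Graph Theory*, §1.9 (dimension of the cycle space).
-/

noncomputable section

open Finset SimpleGraph
open Literature.Probability.LatticeModels
open Literature.Combinatorics.SimpleGraph.CycleSpace

namespace Summit.CriticalPhenomena.Ising3DConformalLimit.Cruxes.ParityRobustMerging.PlaquetteXorSurgery

open scoped Classical

section General

variable {V : Type*}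

/-- The free cluster count of a finite edge set `ω` (no wired vertices) is the number of connected
components of the graph `fromEdgeSet ω` spanned by it. [folklore] -/
theorem clusterCount_coe_empty (ω : Finset (Sym2 V)) :
    clusterCount (↑ω : Set (Sym2 V)) (∅ : Set V) =
      Nat.card (fromEdgeSet (↑ω : Set (Sym2 V))).ConnectedComponent := by
  unfold clusterCount Literature.Probability.Percolation.openGraph
  rw [wired_empty, sup_bot_eq]

/-- The edgeless graph on a finite vertex type has one component per vertex: `k(⊥) = |V|`.
[folklore] -/
theorem card_connectedComponent_bot_eq_card [Fintype V] :
    Nat.card (⊥ : SimpleGraph V).ConnectedComponent = Fintype.card V := by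
  -- adapted from Literature/Computability/QuantumComplexity/JonesLoopCount.lean
  rw [← Nat.card_eq_fintype_card]
  symm
  apply Nat.card_eq_of_bijective (⊥ : SimpleGraph V).connectedComponentMk
  refine ⟨fun a b h => ?_, fun C => C.exists_rep⟩
  rwa [ConnectedComponent.eq, reachable_bot] at h

variable [Fintype V] [DecidableEq V] (G : SimpleGraph V) [DecidableRel G.Adj]

/-- Membership in `𝓔_∅(ω)` for an edge set `ω ⊆ E(G)`: `F` is an even subgraph of `ω` iff
`F ⊆ ω` and every vertex has even `F`-degree. [folklore] -/
theorem mem_evenSubgraphs_iff {ω : Finset (Sym2 V)} (hω : ω ⊆ G.edgeFinset)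
    {F : Finset (Sym2 V)} :
    F ∈ evenSubgraphs G (↑ω : Set (Sym2 V)) ↔ F ⊆ ω ∧ IsEvenEdgeSet F := by
  rw [mem_tJoins, Finset.coe_subset]
  constructor
  · rintro ⟨-, hF, hev⟩
    exact ⟨hF, fun v => Nat.not_odd_iff_even.1 fun h => Finset.notMem_empty v ((hev v).1 h)⟩
  · rintro ⟨hF, hev⟩
    exact ⟨hF.trans hω, hF, fun v =>
      iff_of_false (Nat.not_odd_iff_even.2 (hev v)) (Finset.notMem_empty v)⟩

/-- **No even subgraph uses a bridge between two clusters.**  If `u` and `v` are not joined in the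
graph spanned by `ω`, then an even set `S ⊆ ω + uv` of edges of `G` avoids `uv`: otherwise
`S - uv ⊆ ω` would have odd degree exactly at `u` and `v`, and the handshake lemma in the
component of `u` would join `u` to `v` inside `ω`. [folklore] -/
theorem mk_notMem_of_isEvenEdgeSet {ω : Finset (Sym2 V)} {u v : V}
    (hω : insert s(u, v) ω ⊆ G.edgeFinset)
    (huv : ¬(fromEdgeSet (↑ω : Set (Sym2 V))).Reachable u v) {S : Finset (Sym2 V)}
    (hS : S ⊆ insert s(u, v) ω) (hSeven : IsEvenEdgeSet S) : s(u, v) ∉ S := by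
  intro he
  have hQω : S.erase s(u, v) ⊆ ω := fun x hx =>
    Finset.mem_of_mem_insert_of_ne (hS (Finset.mem_of_mem_erase hx)) (Finset.ne_of_mem_erase hx)
  have hQdiag : ∀ x ∈ S.erase s(u, v), ¬x.IsDiag := fun x hx =>
    G.not_isDiag_of_mem_edgeSet
      (SimpleGraph.mem_edgeFinset.1 (hω (hS (Finset.mem_of_mem_erase hx))))
  have hdeg := edgeDeg_erase_add S he
  have hu : Odd (edgeDeg (S.erase s(u, v)) u) := by
    have h := hdeg u
    rw [if_pos (Sym2.mem_mk_left u v)] at h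
    have hSu := hSeven u
    rw [← h, Nat.even_add_one, Nat.not_even_iff_odd] at hSu
    exact hSu
  obtain ⟨w, hwu, hreach, hwodd⟩ := exists_reachable_odd_of_odd (S.erase s(u, v)) hQdiag hu
  have hwv : w = v := by
    by_contra hwv
    have h := hdeg w
    rw [if_neg (by rw [Sym2.mem_iff, not_or]; exact ⟨hwu, hwv⟩), add_zero] at h
    rw [h] at hwodd
    exact Nat.not_even_iff_odd.2 hwodd (hSeven w)
  subst hwv
  exact huv (hreach.mono (fromEdgeSet_mono (Finset.coe_subset.2 hQω)))

omit [Fintype V] in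
/-- **A cycle through a non-bridge.**  If `u ≠ v` are joined in the graph spanned by `ω` and
`uv ∉ ω`, there is an even edge set `C ⊆ ω + uv` containing `uv`: a `u`–`v` path in `ω` closed
up by `uv`. [folklore] -/
theorem exists_isEvenEdgeSet_insert_of_reachable {ω : Finset (Sym2 V)} {u v : V} (huv : u ≠ v)
    (he : s(u, v) ∉ ω) (hreach : (fromEdgeSet (↑ω : Set (Sym2 V))).Reachable u v) :
    ∃ C : Finset (Sym2 V), C ⊆ insert s(u, v) ω ∧ s(u, v) ∈ C ∧ IsEvenEdgeSet C := by
  obtain ⟨p⟩ := hreach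
  have hpath : p.bypass.IsPath := p.bypass_isPath
  have hsub : walkEdges p.bypass ⊆ ω := fun x hx => by
    have h := mem_edgeSet_of_mem_walkEdges p.bypass hx
    rw [edgeSet_fromEdgeSet] at h
    exact h.1
  have heX : s(u, v) ∉ walkEdges p.bypass := fun h => he (hsub h)
  refine ⟨insert s(u, v) (walkEdges p.bypass), Finset.insert_subset_insert _ hsub,
    Finset.mem_insert_self _ _, fun w => ?_⟩
  have h := edgeDeg_erase_add (insert s(u, v) (walkEdges p.bypass)) (Finset.mem_insert_self _ _) w
  rw [Finset.erase_insert heX] at h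
  rw [← h]
  by_cases hw : w ∈ s(u, v)
  · rw [if_pos hw]
    exact ((odd_edgeDeg_walkEdges_iff hpath huv w).2 (Sym2.mem_iff.1 hw)).add_one
  · rw [if_neg hw, add_zero]
    exact Nat.not_odd_iff_even.1 fun hodd =>
      hw (Sym2.mem_iff.2 ((odd_edgeDeg_walkEdges_iff hpath huv w).1 hodd))

/-- Case (a) of the count: across two clusters of `ω` (`u`, `v` not joined by `ω`) the even
subgraphs of `ω + uv` are those of `ω`. [folklore] -/
theorem evenSubgraphs_insert_of_not_reachable {ω : Finset (Sym2 V)} {u v : V}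
    (hω : insert s(u, v) ω ⊆ G.edgeFinset)
    (huv : ¬(fromEdgeSet (↑ω : Set (Sym2 V))).Reachable u v) :
    evenSubgraphs G (↑(insert s(u, v) ω) : Set (Sym2 V)) = evenSubgraphs G (↑ω : Set (Sym2 V)) := by
  have hω' : ω ⊆ G.edgeFinset := (Finset.subset_insert _ _).trans hω
  ext S
  rw [mem_evenSubgraphs_iff G hω, mem_evenSubgraphs_iff G hω']
  constructor
  · rintro ⟨hS, hev⟩
    have heS := mk_notMem_of_isEvenEdgeSet G hω huv hS hev
    exact ⟨fun x hx => Finset.mem_of_mem_insert_of_ne (hS hx) (ne_of_mem_of_not_mem hx heS), hev⟩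
  · rintro ⟨hS, hev⟩
    exact ⟨hS.trans (Finset.subset_insert _ _), hev⟩

/-- Case (b) of the count: inside one cluster of `ω` (`u ≠ v` joined by `ω`, `uv ∉ ω` an edge of
`G`) the even subgraphs of `ω + uv` are twice as many as those of `ω`: those avoiding `uv` are the
even subgraphs of `ω`, and `S ↦ C ∆ S`, for a fixed even `C ⊆ ω + uv` through `uv`, is a bijection
from the even subgraphs of `ω` onto those of `ω + uv` containing `uv`. [folklore] -/
theorem card_evenSubgraphs_insert_of_reachable {ω : Finset (Sym2 V)} {u v : V}
    (hω : insert s(u, v) ω ⊆ G.edgeFinset) (he : s(u, v) ∉ ω)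
    (hreach : (fromEdgeSet (↑ω : Set (Sym2 V))).Reachable u v) :
    #(evenSubgraphs G (↑(insert s(u, v) ω) : Set (Sym2 V))) =
      2 * #(evenSubgraphs G (↑ω : Set (Sym2 V))) := by
  have hω' : ω ⊆ G.edgeFinset := (Finset.subset_insert _ _).trans hω
  have huv : u ≠ v := by
    have h := hω (Finset.mem_insert_self _ _)
    rw [SimpleGraph.mem_edgeFinset, SimpleGraph.mem_edgeSet] at h
    exact h.ne
  obtain ⟨C, hCsub, heC, hCeven⟩ := exists_isEvenEdgeSet_insert_of_reachable huv he hreach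
  -- the even subgraphs of `ω + uv` avoiding `uv`
  have h0 : (evenSubgraphs G (↑(insert s(u, v) ω) : Set (Sym2 V))).filter (fun S => ¬ s(u, v) ∈ S) =
      evenSubgraphs G (↑ω : Set (Sym2 V)) := by
    ext S
    rw [Finset.mem_filter, mem_evenSubgraphs_iff G hω, mem_evenSubgraphs_iff G hω']
    constructor
    · rintro ⟨⟨hS, hev⟩, heS⟩
      exact ⟨fun x hx => Finset.mem_of_mem_insert_of_ne (hS hx) (ne_of_mem_of_not_mem hx heS), hev⟩
    · rintro ⟨hS, hev⟩
      exact ⟨⟨hS.trans (Finset.subset_insert _ _), hev⟩, fun h => he (hS h)⟩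
  -- the even subgraphs of `ω + uv` through `uv`: `S ↦ C ∆ S` from `𝓔_∅(ω)`
  have h1 :
      #((evenSubgraphs G (↑(insert s(u, v) ω) : Set (Sym2 V))).filter (fun S => s(u, v) ∈ S)) =
        #(evenSubgraphs G (↑ω : Set (Sym2 V))) := by
    symm
    refine Finset.card_nbij' (fun S => symmDiff C S) (fun S => symmDiff C S) ?_ ?_ ?_ ?_
    · intro S hS
      rw [Finset.mem_coe, mem_evenSubgraphs_iff G hω'] at hS
      rw [Finset.mem_coe, Finset.mem_filter, mem_evenSubgraphs_iff G hω]
      refine ⟨⟨fun x hx => ?_, isEvenEdgeSet_symmDiff hCeven hS.2⟩, ?_⟩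
      · rw [Finset.mem_symmDiff] at hx
        rcases hx with ⟨h, -⟩ | ⟨h, -⟩
        · exact hCsub h
        · exact Finset.mem_insert_of_mem (hS.1 h)
      · rw [Finset.mem_symmDiff]
        exact Or.inl ⟨heC, fun h => he (hS.1 h)⟩
    · intro S hS
      rw [Finset.mem_coe, Finset.mem_filter, mem_evenSubgraphs_iff G hω] at hS
      obtain ⟨⟨hS, hev⟩, heS⟩ := hS
      rw [Finset.mem_coe, mem_evenSubgraphs_iff G hω']
      refine ⟨fun x hx => ?_, isEvenEdgeSet_symmDiff hCeven hev⟩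
      rw [Finset.mem_symmDiff] at hx
      have hxe : x ≠ s(u, v) := by
        rintro rfl
        rcases hx with ⟨-, h⟩ | ⟨-, h⟩
        · exact h heS
        · exact h heC
      have hx' : x ∈ insert s(u, v) ω := by
        rcases hx with ⟨h, -⟩ | ⟨h, -⟩
        · exact hCsub h
        · exact hS h
      exact Finset.mem_of_mem_insert_of_ne hx' hxe
    · intro S _
      exact symmDiff_symmDiff_cancel_left C S
    · intro S _
      exact symmDiff_symmDiff_cancel_left C S
  rw [← Finset.card_filter_add_card_filter_not
    (s := evenSubgraphs G (↑(insert s(u, v) ω) : Set (Sym2 V))) (fun S => s(u, v) ∈ S),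
    h0, h1, two_mul]

/-- **The even-subgraph count** (dimension of the cycle space): for an edge set `ω ⊆ E(G)` of a
finite graph, `#𝓔_∅(ω) · 2^{|V|} = 2^{|ω| + k(ω)}` with `k(ω) = clusterCount ω ∅` the number of
connected components of `(V, ω)`.  Induction on `ω`: adding an edge `uv` either merges two
clusters (`k ↦ k − 1`, `𝓔_∅` unchanged) or closes a cycle (`k` unchanged, `𝓔_∅` doubles).
(Grimmett–Janson 2009, §1; Diestel, *Graph Theory*, §1.9.) [folklore] -/
theorem card_evenSubgraphs_mul_two_pow (ω : Finset (Sym2 V)) (hω : ω ⊆ G.edgeFinset) :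
    #(evenSubgraphs G (↑ω : Set (Sym2 V))) * 2 ^ Fintype.card V =
      2 ^ (#ω + clusterCount (↑ω : Set (Sym2 V)) (∅ : Set V)) := by
  rw [clusterCount_coe_empty]
  induction ω using Finset.induction_on with
  | empty =>
    have h0 : evenSubgraphs G (↑(∅ : Finset (Sym2 V)) : Set (Sym2 V)) = {∅} := by
      ext F
      rw [mem_evenSubgraphs_iff G (Finset.empty_subset _), Finset.mem_singleton,
        Finset.subset_empty]
      constructor
      · exact fun h => h.1
      · rintro rfl
        exact ⟨rfl, fun v => by simp [edgeDeg]⟩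
    rw [h0, Finset.card_singleton, one_mul, Finset.card_empty, zero_add, Finset.coe_empty,
      fromEdgeSet_empty, card_connectedComponent_bot_eq_card]
  | insert e ω heω ih =>
    have hω' : ω ⊆ G.edgeFinset := (Finset.subset_insert _ _).trans hω
    induction e using Sym2.ind with
    | h u v =>
    have hins : fromEdgeSet (↑(insert s(u, v) ω) : Set (Sym2 V)) =
        fromEdgeSet (↑ω : Set (Sym2 V)) ⊔ edge u v := by
      rw [Finset.coe_insert, Set.insert_eq, fromEdgeSet_union, sup_comm]; rfl
    rw [hins, Finset.card_insert_of_notMem heω]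
    by_cases hreach : (fromEdgeSet (↑ω : Set (Sym2 V))).Reachable u v
    · -- `uv` closes a cycle: `k` unchanged, `𝓔_∅` doubles
      rw [card_connectedComponent_sup_edge_of_reachable _ hreach,
        card_evenSubgraphs_insert_of_reachable G hω heω hreach, mul_assoc, ih hω',
        Nat.add_right_comm, pow_succ, mul_comm]
    · -- `uv` merges two clusters: `k` drops by one, `𝓔_∅` unchanged
      have hlt := card_connectedComponent_sup_edge_lt (fromEdgeSet (↑ω : Set (Sym2 V))) hreach
      have hle := card_connectedComponent_le_sup_edge_add_one (fromEdgeSet (↑ω : Set (Sym2 V))) u v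
      rw [evenSubgraphs_insert_of_not_reachable G hω hreach, ih hω']
      congr 1
      omega

end General

/-- STUB `stub_evenSubgraphCount` (EC) of the skeleton `Lines/plaquette-xor-surgery.lean` (crux
`ParityRobustMerging`, stmt-CriticalPhenomena-11253), verbatim: the EVEN-SUBGRAPH COUNT
`#𝓔_∅(ω) · 2^{|V|} = 2^{|ω| + k(ω)}` for every edge set `ω ⊆ E(G)` of a finite graph, with
`𝓔_∅(ω) = evenSubgraphs G ω` and `k(ω) = clusterCount ω ∅` the number of connected components of
`(V, ω)` (`card_evenSubgraphs_mul_two_pow` in closed form). -/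
theorem stub_evenSubgraphCount :
    ∀ (V : Type) [Fintype V] [DecidableEq V] (G : SimpleGraph V) [DecidableRel G.Adj]
      (ω : Finset (Sym2 V)), ω ⊆ G.edgeFinset →
        #(evenSubgraphs G (↑ω : Set (Sym2 V))) * 2 ^ Fintype.card V =
          2 ^ (#ω + clusterCount (↑ω : Set (Sym2 V)) (∅ : Set V)) := by
  intro V _ _ G _ ω hω
  exact card_evenSubgraphs_mul_two_pow G ω hω

end Summit.CriticalPhenomena.Ising3DConformalLimit.Cruxes.ParityRobustMerging.PlaquetteXorSurgery

end
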